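import Summits.CriticalPhenomena.CardyFormulaZ2.Theorems.HalfPlaneOneArmThird.Negative.Window
import Literature.Probability.Percolation.HalfPlaneCriticalProb

/-!
# `HalfPlaneOneArmThird` (stmt-CriticalPhenomena-5662), negative side III: the supercritical limit
# is `0`; the statement is false at EVERY `p ≠ 1/2`

Part III of the negative-side support for the crux `HalfPlaneOneArmThird` (see `Basics.lean`,
`Window.lean`).

* `theta_halfSpace_le_prob`: `θ_ℍ(p) ≤ P_p[armEvt n]` — percolation of the origin inside the
  half-plane forces the crux event at every scale (`mem_openCrossing_of_percolates_halfSpace`: first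
  exit of an open `ℍ`-path to a far point from the half-box, via `exists_prefix_within_edges`; the
  tree's half-space is `{0 ≤ x₀}`, reached from the crux's `{0 ≤ x₁}` by `transposeIso`,
  `prob_eq_transposed`);
* `theta_halfSpace_pos`: `θ_ℍ(p) > 0` for `p > 1/2` (`criticalProb_halfSpace_two`, `theta_mono_holds`);
* `exponentAt_iff_of_half_lt`: for `p > 1/2`, `ExponentAt p β ↔ β = 0` (squeeze
  `log θ_ℍ / log n ≤ log P_n / log n ≤ 0`);
* `crux_false_of_ne_half`: **`HalfPlaneOneArmThird` with `half` replaced by any `p ≠ 1/2` is false**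
  — so any proof of the crux must use both `p_c(ℤ²) ≤ 1/2` (sharpness side) and `p_c(ℍ) ≥ 1/2`
  (Harris side); the exponent `1/3` is a genuinely critical quantity.
-/

noncomputable section

namespace Summit.CriticalPhenomena.CardyFormulaZ2.Theorems.HalfPlaneOneArmThird.Negative

open MeasureTheory ProbabilityTheory Filter Topology
open Literature.Probability.Percolation Literature.Probability.LatticeModels

/-! ### Supercritical `p > 1/2`: the limit exists and is `0` -/

/-- The transposed half-box `[0, n] × [-n, n]` (image of `halfBox n` under `x ↦ (x₁, x₀)`). -/
def halfBoxT (n : ℕ) : Set (Site 2) := {v | 0 ≤ v 0 ∧ -(n : ℤ) ≤ v 1 ∧ v 1 ≤ n ∧ v 0 ≤ n}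

/-- The transposed target. -/
def tgtT (n : ℕ) : Set (Site 2) := {y | y 1 = (n : ℤ) ∨ y 1 = -(n : ℤ) ∨ y 0 = (n : ℤ)}

/-- Transposition maps the half-box onto the transposed half-box. -/
theorem image_transpose_halfBox (n : ℕ) :
    (transposeIso : Site 2 → Site 2) '' halfBox n = halfBoxT n := by
  rw [image_transposeIso]; ext v; simp [halfBox, halfBoxT]

/-- Transposition maps the target onto the transposed target. -/
theorem image_transpose_tgt (n : ℕ) : (transposeIso : Site 2 → Site 2) '' tgt n = tgtT n := by
  rw [image_transposeIso]; ext v; simp [tgt, tgtT]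

/-- Transposition fixes the origin. -/
theorem transposeIso_zero : (transposeIso : Site 2 → Site 2) 0 = 0 := by
  ext i; fin_cases i <;> simp

/-- Transposition fixes `{0}`. -/
theorem image_transpose_zero :
    (transposeIso : Site 2 → Site 2) '' {(0 : Site 2)} = {(0 : Site 2)} := by
  simp only [Set.image_singleton, transposeIso_zero]

/-- The crux probability equals that of the transposed event (coordinate swap symmetry of
`P_p` on `ℤ²`), which lives in the tree's half-space `ℍ = {0 ≤ x₀}`. -/
theorem prob_eq_transposed (p : unitInterval) (n : ℕ) :
    prob p n = (bondPercolation (zdGraph 2) p).real (openCrossing (halfBoxT n) {(0 : Site 2)} (tgtT n)) := by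
  rw [prob, armEvt_eq_openCrossing]
  have h := bondPercolation_real_image transposeIso p (halfBox n) {(0 : Site 2)} (tgt n)
  rw [image_transpose_halfBox, image_transpose_tgt, image_transpose_zero] at h
  exact h.symm

/-- Walks of the open graph induced on `A` whose support lies in `B` give connections in `B`. -/
theorem reachable_induce_of_walk {ω : BondConfig (Site 2)} {A B : Set (Site 2)} {u v : A}
    (W : ((openGraph ω).induce A).Walk u v) (hW : ∀ x ∈ W.support, (x : Site 2) ∈ B) :
    ∃ (hu : (u : Site 2) ∈ B) (hv : (v : Site 2) ∈ B),
      ((openGraph ω).induce B).Reachable ⟨u, hu⟩ ⟨v, hv⟩ := by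
  induction W with
  | nil =>
    rename_i u
    exact ⟨hW u (SimpleGraph.Walk.start_mem_support _), hW u (SimpleGraph.Walk.start_mem_support _),
      SimpleGraph.Reachable.refl _⟩
  | cons h W ih =>
    rename_i u w v
    have hu : (u : Site 2) ∈ B := hW u (SimpleGraph.Walk.start_mem_support _)
    obtain ⟨hw, hv, hr⟩ := ih fun x hx => hW x (by simp [hx])
    refine ⟨hu, hv, SimpleGraph.Reachable.trans (SimpleGraph.Adj.reachable ?_) hr⟩
    rw [SimpleGraph.induce_adj] at h ⊢
    exact h

/-- **Percolation in `ℍ` forces the (transposed) crux event at every scale**: on lattice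
configurations, if the open cluster of the origin computed inside `ℍ = {0 ≤ x₀}` is infinite then
`0` is joined inside `[0, n] × [-n, n]` to the outer boundary of that half-box (first exit of an
open `ℍ`-path to a far point). -/
theorem mem_openCrossing_of_percolates_halfSpace {n : ℕ} {ω : BondConfig (Site 2)}
    (hω : ω ⊆ (zdGraph 2).edgeSet)
    (hperc : ω ∈ restrictConfig (Subtype.val : halfSpace 2 → Site 2) ⁻¹' percolatesAt (halfSpaceOrigin 2)) :
    ω ∈ openCrossing (halfBoxT n) {(0 : Site 2)} (tgtT n) := by
  classical
  -- a point of the `ℍ`-cluster of the origin outside `B(n)`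
  have hinf : (openCluster (restrictConfig (Subtype.val : halfSpace 2 → Site 2) ω)
      (halfSpaceOrigin 2)).Infinite := hperc
  obtain ⟨y, hyC, hyT⟩ := hinf.exists_notMem_finset ((box 2 n).subtype (· ∈ halfSpace 2))
  rw [Finset.mem_subtype] at hyT
  have hy0 : 0 ≤ (y : Site 2) 0 := y.2
  -- an open walk inside `ℍ`
  have hr : ((openGraph ω).induce (halfSpace 2)).Reachable (halfSpaceOrigin 2) y := by
    rw [induce_openGraph_eq]; exact hyC
  obtain ⟨W⟩ := hr
  -- first exit from the half-box
  set S : Set (halfSpace 2) := {v | (v : Site 2) 0 ≤ n ∧ -(n : ℤ) ≤ (v : Site 2) 1 ∧ (v : Site 2) 1 ≤ n}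
    with hS
  have h0S : halfSpaceOrigin 2 ∈ S := by
    simp only [hS, Set.mem_setOf_eq, halfSpaceOrigin, Pi.zero_apply]; omega
  have hyS : y ∉ S := by
    intro h
    simp only [hS, Set.mem_setOf_eq] at h
    apply hyT
    simp only [mem_box, Fin.forall_fin_two]
    omega
  obtain ⟨f, g, hf, hg, hadj, W', -, -, hW'⟩ := exists_prefix_within_edges S W h0S hyS
  -- the exit vertex `f` lies on the outer boundary of the half-box
  have hadj' : (zdGraph 2).Adj (f : Site 2) (g : Site 2) := by
    rw [SimpleGraph.induce_adj, openGraph_adj] at hadj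
    exact hω hadj.1
  have h0 := zdGraph_adj_apply_le hadj' 0
  have h1 := zdGraph_adj_apply_le hadj' 1
  have hg0 : 0 ≤ (g : Site 2) 0 := g.2
  simp only [hS, Set.mem_setOf_eq, not_and_or, not_le] at hf hg
  have hft : (f : Site 2) ∈ tgtT n := by
    simp only [tgtT, Set.mem_setOf_eq]; omega
  -- the prefix walk is a connection inside the half-box
  have hsupp : ∀ x ∈ W'.support, (x : Site 2) ∈ halfBoxT n := by
    intro x hx
    have := hW' x hx
    simp only [hS, Set.mem_setOf_eq] at this
    simp only [halfBoxT, Set.mem_setOf_eq]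
    exact ⟨x.2, this.2.1, this.2.2, this.1⟩
  obtain ⟨hu, hv, hreach⟩ := reachable_induce_of_walk W' hsupp
  exact ⟨0, rfl, f, hft, hu, hv, hreach⟩

/-- **The half-plane percolation probability bounds the crux probability from below**:
`θ_ℍ(p) ≤ P_p[armEvt n]` for every `n`. -/
theorem theta_halfSpace_le_prob (p : unitInterval) (n : ℕ) :
    theta (halfSpaceGraph 2) (halfSpaceOrigin 2) p ≤ prob p n := by
  change theta ((zdGraph 2).comap (Subtype.val : halfSpace 2 → Site 2)) (halfSpaceOrigin 2) p ≤ _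
  rw [theta_comap_eq _ Subtype.val_injective, prob_eq_transposed]
  refine ENNReal.toReal_mono (measure_ne_top _ _) (measure_mono_ae ?_)
  filter_upwards [ae_subset_edgeSet (zdGraph 2) p] with ω hω hperc
  exact mem_openCrossing_of_percolates_halfSpace hω hperc

/-- **`θ_ℍ(p) > 0` for `p > 1/2`**: `p_c(ℍ) = 1/2` for the half-plane of bond-`ℤ²` (tree:
`criticalProb_halfSpace_two`, from Kesten's theorem and long crossings above `1/2`), and `θ_ℍ` is
monotone (`theta_mono_holds`). -/
theorem theta_halfSpace_pos {p : unitInterval} (hp : 1 / 2 < (p : ℝ)) :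
    0 < theta (halfSpaceGraph 2) (halfSpaceOrigin 2) p := by
  have hlt : sInf ({q : ℝ | ∃ h : q ∈ unitInterval, 0 < theta (halfSpaceGraph 2) (halfSpaceOrigin 2) ⟨q, h⟩}
      ∪ {1}) < p := by
    have := criticalProb_halfSpace_two
    unfold criticalProb at this
    rw [this]; exact hp
  have hne : ({q : ℝ | ∃ h : q ∈ unitInterval, 0 < theta (halfSpaceGraph 2) (halfSpaceOrigin 2) ⟨q, h⟩}
      ∪ {1}).Nonempty := ⟨1, Or.inr rfl⟩
  obtain ⟨a, ha, hap⟩ := exists_lt_of_csInf_lt hne hlt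
  rcases ha with ⟨ha01, hθ⟩ | ha1
  · exact hθ.trans_le (theta_mono_holds (halfSpaceGraph 2) (halfSpaceOrigin 2)
      (show (⟨a, ha01⟩ : unitInterval) ≤ p from hap.le))
  · rw [Set.mem_singleton_iff] at ha1
    exact absurd (ha1 ▸ hap) (not_lt.2 p.2.2)

/-- For `p > 1/2` the crux sequence tends to `0`: `log P_n` is bounded between `log θ_ℍ(p)` and
`0`. -/
theorem tendsto_zero_of_half_lt {p : unitInterval} (hp : 1 / 2 < (p : ℝ)) :
    Tendsto (fun n : ℕ ↦ Real.log (prob p n) / Real.log n) atTop (𝓝 0) := by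
  have hθ := theta_halfSpace_pos hp
  set L : ℝ := Real.log (theta (halfSpaceGraph 2) (halfSpaceOrigin 2) p) with hL
  have hlow : Tendsto (fun n : ℕ => L / Real.log n) atTop (𝓝 0) :=
    tendsto_const_nhds.div_atTop (Real.tendsto_log_atTop.comp tendsto_natCast_atTop_atTop)
  refine tendsto_of_tendsto_of_tendsto_of_le_of_le' hlow tendsto_const_nhds ?_ ?_
  · filter_upwards [eventually_ge_atTop 2] with n hn
    have hn' : (2 : ℝ) ≤ n := by exact_mod_cast hn
    have hlog : 0 < Real.log n := Real.log_pos (by linarith)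
    rw [div_le_div_iff_of_pos_right hlog, hL]
    exact Real.log_le_log hθ (theta_halfSpace_le_prob p n)
  · filter_upwards [eventually_ge_atTop 2] with n hn
    have hn' : (2 : ℝ) ≤ n := by exact_mod_cast hn
    have hlog : 0 < Real.log n := Real.log_pos (by linarith)
    have hP : 0 < prob p n := prob_pos (by linarith) n
    exact div_nonpos_of_nonpos_of_nonneg (Real.log_nonpos hP.le (prob_le_one p n)) hlog.le

/-- **(a) Supercritical parameters are refuted**: for `p > 1/2` the limit exists and equals `0`,
so `ExponentAt p β ↔ β = 0`; any proof of the crux must use that `1/2` is not supercritical for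
the HALF-PLANE, i.e. `p_c(ℍ) ≥ 1/2` (Harris' side). -/
theorem exponentAt_iff_of_half_lt {p : unitInterval} (hp : 1 / 2 < (p : ℝ)) (β : ℝ) :
    ExponentAt p β ↔ β = 0 := by
  constructor
  · intro h
    have := tendsto_nhds_unique h (tendsto_zero_of_half_lt hp)
    linarith
  · rintro rfl
    simpa [ExponentAt] using tendsto_zero_of_half_lt hp

/-- **The parameter is pinned: `HalfPlaneOneArmThird` is false at EVERY `p ≠ 1/2`.**  At `p = 0`
and `p > 1/2` the limit is `0`; for `0 < p < 1/2` there is no limit. -/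
theorem crux_false_of_ne_half {p : unitInterval} (hp : (p : ℝ) ≠ 1 / 2) : ¬ ExponentAt p (1 / 3) := by
  rcases lt_or_gt_of_ne hp with hlt | hgt
  · rcases (p.2.1).eq_or_lt with h0 | h0
    · have : p = 0 := Subtype.ext h0.symm
      subst this
      rw [exponentAt_zero_iff]; norm_num
    · exact not_exponentAt_of_lt_half h0 hlt _
  · rw [exponentAt_iff_of_half_lt hgt]; norm_num

end Summit.CriticalPhenomena.CardyFormulaZ2.Theorems.HalfPlaneOneArmThird.Negative

end
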